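import Literature.NumberTheory.GaloisRepresentations.WeilDeligneOfGalois
import HarnessLib

/-!
# Weil–Deligne bookkeeping (WD-B): transport along `ι : E →+* C` preserves isomorphism

Discharges hypothesis (WD-B) of `SoloBlind.recGL_eq_of_globalLanglands`
(`SoloBlindLocalAgreement`): if `r ≅ r'` are isomorphic Weil–Deligne representations on `Eⁿ` and
`r_C`, `r'_C` are their transports along a ring homomorphism `ι : E → C` in the standard bases
(`WeilDeligneRep.IsTransportAlong`: matrices mapped entrywise by `ι`), then `r_C ≅ r'_C` — the
intertwining matrix mapped by `ι` intertwines.  Pure matrix algebra.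

## References

* P. Deligne, *Les constantes des équations fonctionnelles des fonctions L*, Antwerp II, LNM 349
  (1973), §8.4.1. [DeligneAntwerpII1973]
* J. Tate, *Number theoretic background*, Corvallis 1979, (4.1.2). [TateCorvallis1979]
-/

open Module Matrix

noncomputable section

namespace Summit.Langlands.Langlands.Theorems

namespace SoloBlind

open Literature.NumberTheory.GaloisRepresentations

variable {F : Type*} [Field F] [ValuativeRel F] [TopologicalSpace F] [IsNonarchimedeanLocalField F]
variable {E : Type*} [Field E] [CharZero E] {C : Type*} [Field C] [CharZero C] {n : ℕ}

/-- **(WD-B) Transport along a ring homomorphism preserves isomorphism of Weil–Deligne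
representations** (standard coordinates on `Eⁿ`, `Cⁿ`). [cite: DeligneAntwerpII1973, §8.4.1] -/
theorem wd_isEquivalent_of_isTransportAlong (ι : E →+* C)
    {r r' : WeilDeligneRep F E (Fin n → E)} {rC rC' : WeilDeligneRep F C (Fin n → C)}
    (he : r.IsEquivalent r') (ht : r.IsTransportAlong ι rC) (ht' : r'.IsTransportAlong ι rC') :
    rC.IsEquivalent rC' := by
  obtain ⟨e⟩ := he
  set P : Matrix (Fin n) (Fin n) E := LinearMap.toMatrix' (e.toLinearEquiv : (Fin n → E) →ₗ[E] (Fin n → E))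
    with hP
  set Q : Matrix (Fin n) (Fin n) E :=
    LinearMap.toMatrix' (e.toLinearEquiv.symm : (Fin n → E) →ₗ[E] (Fin n → E)) with hQ
  have hPQ : P * Q = 1 := by
    rw [hP, hQ, ← LinearMap.toMatrix'_comp, LinearEquiv.comp_symm, LinearMap.toMatrix'_id]
  have hQP : Q * P = 1 := by
    rw [hP, hQ, ← LinearMap.toMatrix'_comp, LinearEquiv.symm_comp, LinearMap.toMatrix'_id]
  have hρ : ∀ w, P * LinearMap.toMatrix' (r.ρ w) = LinearMap.toMatrix' (r'.ρ w) * P := fun w ↦ by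
    rw [hP, ← LinearMap.toMatrix'_comp, ← LinearMap.toMatrix'_comp]
    exact congrArg _ (e.toRepEquiv.isIntertwining' w)
  have hN : P * LinearMap.toMatrix' r.N = LinearMap.toMatrix' r'.N * P := by
    rw [hP, ← LinearMap.toMatrix'_comp, ← LinearMap.toMatrix'_comp]
    exact congrArg _ e.comm_N
  -- map everything along `ι`
  have hPQι : ι.mapMatrix P * ι.mapMatrix Q = 1 := by rw [← map_mul, hPQ, map_one]
  have hQPι : ι.mapMatrix Q * ι.mapMatrix P = 1 := by rw [← map_mul, hQP, map_one]
  let eC : (Fin n → C) ≃ₗ[C] (Fin n → C) :=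
    LinearEquiv.ofLinear (Matrix.toLin' (ι.mapMatrix P)) (Matrix.toLin' (ι.mapMatrix Q))
      (by rw [← Matrix.toLin'_mul, hPQι, Matrix.toLin'_one])
      (by rw [← Matrix.toLin'_mul, hQPι, Matrix.toLin'_one])
  have heC : LinearMap.toMatrix' (eC : (Fin n → C) →ₗ[C] (Fin n → C)) = ι.mapMatrix P := by
    change LinearMap.toMatrix' (Matrix.toLin' (ι.mapMatrix P)) = _
    rw [LinearMap.toMatrix'_toLin']
  have hρC : ∀ w, (eC : (Fin n → C) →ₗ[C] (Fin n → C)) ∘ₗ rC.ρ w =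
      rC'.ρ w ∘ₗ (eC : (Fin n → C) →ₗ[C] (Fin n → C)) := fun w ↦ by
    apply LinearMap.toMatrix'.injective
    rw [LinearMap.toMatrix'_comp, LinearMap.toMatrix'_comp, heC, ht.1 w, ht'.1 w]
    change ι.mapMatrix P * ι.mapMatrix (LinearMap.toMatrix' (r.ρ w)) =
      ι.mapMatrix (LinearMap.toMatrix' (r'.ρ w)) * ι.mapMatrix P
    rw [← map_mul ι.mapMatrix, ← map_mul ι.mapMatrix, hρ w]
  have hNC : (eC : (Fin n → C) →ₗ[C] (Fin n → C)) ∘ₗ rC.N =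
      rC'.N ∘ₗ (eC : (Fin n → C) →ₗ[C] (Fin n → C)) := by
    apply LinearMap.toMatrix'.injective
    rw [LinearMap.toMatrix'_comp, LinearMap.toMatrix'_comp, heC, ht.2, ht'.2]
    change ι.mapMatrix P * ι.mapMatrix (LinearMap.toMatrix' r.N) =
      ι.mapMatrix (LinearMap.toMatrix' r'.N) * ι.mapMatrix P
    rw [← map_mul ι.mapMatrix, ← map_mul ι.mapMatrix, hN]
  exact ⟨{ toRepEquiv := Representation.Equiv.mk eC hρC, comm_N := hNC }⟩

end SoloBlind

end Summit.Langlands.Langlands.Theorems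

end
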